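import Literature.NumberTheory.EllipticCurves.Gross2004.RationalCharacterFrobeniusProofs
import Literature.NumberTheory.GaloisRepresentations.QuadraticInertiaDiscriminant
import Literature.NumberTheory.GaloisRepresentations.AbsIntegersEquiv
import Literature.NumberTheory.GaloisRepresentations.ArtinRestriction
import Literature.NumberTheory.QuadraticFields.ThreeTorsion
import Literature.NumberTheory.QuadraticFields.FundamentalDiscriminant
import HarnessLib

/-!
# Gross's rational ring class characters in Galois currency, II: the character is RAMIFIED above
# the primes dividing the conductor (`heckeValueAt χ_gal v = 0` for `v ∣ c`)

Topic `NumberTheory/EllipticCurves`, paper namespace `Literature.NumberTheory.EllipticCurves.Gross2004`;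
theorems only (no definition, no named fact). Sequel of `RationalCharacterFrobeniusProofs.lean`
(values at the unramified places). Setting of Gross 2004, MSRI Publ. 49, §1–§2 (pp. 38–40): `K` a
quadratic field of discriminant `d_K`, `𝒪` the order of conductor `c`, `D = d_K c²`, and a
RATIONAL ring class character `χ` "corresponding to a factorization `D = d₁ d₂` into two
fundamental discriminants" — in Galois currency `IsRationalCharacterFor χ_gal d₁` (`χ_gal(γ) = +1`
iff `γ` fixes `√d₁`). We prove:

* `Int.dvd_of_prime_dvd_conductor` — **every prime `p ∣ c` divides `d₁` (and `d₂`)**: from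
  `d₁ d₂ = d_K c²` with `d₁, d₂` fundamental and `d_K ≡ 0, 1 (mod 4)` (`p ∤ d₁` would force
  `p² ∣ d₂`, impossible for odd `p`; for `p = 2` the residual identity `d₁ m = d_K c'²`,
  `d₂ = 4m`, `m ≡ 2, 3 (mod 4)`, contradicts Stickelberger).
* `not_isUnramifiedAt_of_isRationalCharacterFor_of_dvd_conductor` — **`χ_gal` is ramified at
  every place `v ∣ p` of `K` for `p ∣ c`**: an inertia element of `Γ_ℚ` at `p` negating `√d₁`
  (`exists_mem_inertia_smul_eq_neg_of_sq_eq_fundamental`, `p ∣ d₁`), corrected if necessary by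
  one negating `√d₂` (`p ∣ d₂`; `√d₁ √d₂ = c √d_K`) so as to FIX `√d_K`, lies in the image of
  `Γ_K` (`mem_range_absGaloisRestrict_iff_smul_gen_eq`: `res(Γ_K)` is the stabiliser of `√d_K`),
  i.e. is `res σ` for an inertia element `σ` of `Γ_K` above `v` (`comap_inertia_comap_absIntegersMap`)
  with `σ √d₁ = −√d₁`, `χ_gal(σ) = −1`.
* `heckeValueAt_eq_zero_of_isRationalCharacterFor_of_dvd_conductor` — hence
  `heckeValueAt χ_gal v = 0` ("`𝒲` extended by zero", Nekovář 1995 §3.4): the Rankin–Selberg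
  Euler factor of `L(f, χ, s)` at `v ∣ c` is `1`, matching the trivial Euler factors at `p ∣ c`
  of the two quadratic twists `A₁ = E^{(d₁)}`, `A₂ = E^{(d₂)}` (additive reduction) in Gross's
  factorisation `L(f, χ, s) = L(A₁, s) L(A₂, s)`.

This is the classical statement that a genus character of the order of conductor `c` attached to
`D = d₁ d₂` has conductor exactly `c`, i.e. is ramified precisely above the primes dividing `c`
(Cox, *Primes of the form x² + ny²*, §7 and Thm. 7.22 / Gross 2004 §2; Neukirch I §8–§9 for the
ramification of `ℚ(√d)` and inertia groups).

## References

* [Gross2004] B. H. Gross, *Heegner points and representation theory*, MSRI Publ. 49 (2004), §1–§2.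
* [NeukirchANT1999] J. Neukirch, *Algebraic Number Theory* (1999), Ch. I §8, §9 (9.4)–(9.6).
* [Nekovar1995] J. Nekovář, Math. Ann. 302 (1995), §3.4.
* [Cox2013] D. A. Cox, *Primes of the form x² + ny²*, 2nd ed., §7.D (ring class fields and genus
  theory of orders).
-/

noncomputable section

open scoped NumberField
open Field IsDedekindDomain NumberField Polynomial Module
open Literature.NumberTheory.GaloisRepresentations
open Literature.NumberTheory.QuadraticFields

namespace Literature.NumberTheory.EllipticCurves

namespace Gross2004

universe u

/-! ## The primes dividing the conductor divide both `d₁` and `d₂` -/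

/-- If `p² ∣ d` for a fundamental discriminant `d` then `p = 2`... more precisely: an odd prime
square never divides a fundamental discriminant, and `4 ∣ d` forces the even shape. We only need:
`p² ∣ d`, `d` fundamental, `p` prime ⟹ `p = 2`. [folklore] -/
private theorem eq_two_of_sq_dvd_fundamental {d : ℤ}
    (hfund : (d % 4 = 1 ∧ Squarefree d ∧ d ≠ 1) ∨
      (4 ∣ d ∧ (d / 4 % 4 = 2 ∨ d / 4 % 4 = 3) ∧ Squarefree (d / 4)))
    {p : ℕ} (hp : p.Prime) (h : (p : ℤ) ^ 2 ∣ d) : p = 2 := by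
  have hpu : ¬ IsUnit (p : ℤ) := by
    rw [Int.isUnit_iff_natAbs_eq, Int.natAbs_natCast]; exact hp.one_lt.ne'
  rcases hfund with ⟨-, hsq, -⟩ | ⟨h4, -, hsq⟩
  · exact absurd (hsq _ (by rw [← sq]; exact h)) hpu
  · by_contra hp2
    obtain ⟨m, rfl⟩ := h4
    have hm4 : 4 * m / 4 = m := by omega
    rw [hm4] at hsq
    have hpi : Prime (p : ℤ) := Nat.prime_iff_prime_int.mp hp
    -- `p² ∣ 4m` with `p` odd gives `p² ∣ m`
    have hp4 : ¬ (p : ℤ) ∣ 4 := by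
      intro hd
      have h' : (p : ℤ) ∣ 2 ^ 2 := by norm_num; exact hd
      have h2 := Int.natAbs_dvd_natAbs.mpr (hpi.dvd_of_dvd_pow h')
      simp only [Int.natAbs_natCast, Int.reduceAbs, Nat.dvd_prime Nat.prime_two] at h2
      rcases h2 with h2 | h2
      · exact hp.one_lt.ne' h2
      · exact hp2 h2
    have hpm : (p : ℤ) ∣ m := (hpi.dvd_or_dvd (dvd_trans (dvd_pow_self _ two_ne_zero) h)).resolve_left hp4
    obtain ⟨m₁, rfl⟩ := hpm
    have hp0 : (p : ℤ) ≠ 0 := by exact_mod_cast hp.ne_zero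
    have h1 : (p : ℤ) ∣ 4 * m₁ := by
      obtain ⟨e, he⟩ := h
      refine ⟨e, mul_left_cancel₀ hp0 ?_⟩
      calc (p : ℤ) * (4 * m₁) = 4 * (p * m₁) := by ring
        _ = p ^ 2 * e := he
        _ = p * (p * e) := by ring
    obtain ⟨m₂, rfl⟩ := (hpi.dvd_or_dvd h1).resolve_left hp4
    exact hpu (hsq _ ⟨m₂, by ring⟩)

/-- **A prime dividing the conductor divides `d₁`.** Let `d₁ d₂ = d c²` with `d₁`, `d₂`
fundamental discriminants and `d ≡ 0` or `1 (mod 4)` (e.g. `d = d_K` a field discriminant,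
Stickelberger). Then every prime `p ∣ c` divides `d₁` (and, symmetrically, `d₂`): otherwise
`p² ∣ d₂`, which for a fundamental `d₂` forces `p = 2`, `d₂ = 4m` with `m ≡ 2, 3 (mod 4)`, and
then `d₁ m = d c'²` (`c = 2c'`, `c'` odd, `d₁ ≡ 1 (mod 4)`) gives `d ≡ m (mod 4)`, contradicting
`d ≡ 0, 1 (mod 4)`. (In Gross's setting: the genus character of `𝒪 = ℤ + c𝒪_K` attached to
`D = d₁d₂` has conductor `c`, so `c² ∣ D` sits inside `d₁ d₂` prime by prime.)
[cite: Gross2004, §1 p. 38 (D = d_K c²) and §2 p. 40 (D = d₁ d₂)] -/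
theorem Int.dvd_of_prime_dvd_conductor {d d₁ d₂ : ℤ} {c : ℕ} (hd4 : d % 4 = 0 ∨ d % 4 = 1)
    (hfund₁ : (d₁ % 4 = 1 ∧ Squarefree d₁ ∧ d₁ ≠ 1) ∨
      (4 ∣ d₁ ∧ (d₁ / 4 % 4 = 2 ∨ d₁ / 4 % 4 = 3) ∧ Squarefree (d₁ / 4)))
    (hfund₂ : (d₂ % 4 = 1 ∧ Squarefree d₂ ∧ d₂ ≠ 1) ∨
      (4 ∣ d₂ ∧ (d₂ / 4 % 4 = 2 ∨ d₂ / 4 % 4 = 3) ∧ Squarefree (d₂ / 4)))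
    (hD : d₁ * d₂ = d * (c : ℤ) ^ 2) {p : ℕ} (hp : p.Prime) (hpc : p ∣ c) : (p : ℤ) ∣ d₁ := by
  by_contra hpd₁
  have hpi : Prime (p : ℤ) := Nat.prime_iff_prime_int.mp hp
  obtain ⟨c', rfl⟩ := hpc
  -- `p² ∣ d₂`
  have hp2d₂ : (p : ℤ) ^ 2 ∣ d₂ := by
    have h1 : (p : ℤ) ∣ d₁ * d₂ := ⟨d * p * (c' : ℤ) ^ 2, by rw [hD]; push_cast; ring⟩
    obtain ⟨d₂', rfl⟩ := (hpi.dvd_or_dvd h1).resolve_left hpd₁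
    have hp0 : (p : ℤ) ≠ 0 := by exact_mod_cast hp.ne_zero
    have h2 : (p : ℤ) ∣ d₁ * d₂' := by
      refine ⟨d * (c' : ℤ) ^ 2, mul_left_cancel₀ hp0 ?_⟩
      calc (p : ℤ) * (d₁ * d₂') = d₁ * (p * d₂') := by ring
        _ = d * ((p * c' : ℕ) : ℤ) ^ 2 := hD
        _ = p * (p * (d * (c' : ℤ) ^ 2)) := by push_cast; ring
    obtain ⟨d₂'', rfl⟩ := (hpi.dvd_or_dvd h2).resolve_left hpd₁
    exact ⟨d₂'', by ring⟩
  have hp2 : p = 2 := eq_two_of_sq_dvd_fundamental hfund₂ hp hp2d₂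
  subst hp2
  -- `d₁` is odd, hence `d₁ ≡ 1 (mod 4)`; `d₂ = 4m` with `m ≡ 2, 3 (mod 4)`
  have hd₁odd : d₁ % 4 = 1 := by
    rcases hfund₁ with ⟨h1, -, -⟩ | ⟨h4, -, -⟩
    · exact h1
    · exact absurd (dvd_trans (by norm_num : (2 : ℤ) ∣ 4) h4) (by exact_mod_cast hpd₁)
  rcases hfund₂ with ⟨h1, -, -⟩ | ⟨⟨m, rfl⟩, hm, -⟩
  · have : (2 : ℤ) ∣ d₂ := dvd_trans (dvd_pow_self _ two_ne_zero) (by exact_mod_cast hp2d₂)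
    omega
  · have hm4 : 4 * m / 4 = m := by omega
    rw [hm4] at hm
    -- `d₁ m = d c'²`
    have hE : d₁ * m = d * (c' : ℤ) ^ 2 := by
      have h4 : (4 : ℤ) ≠ 0 := by norm_num
      apply mul_left_cancel₀ h4
      calc (4 : ℤ) * (d₁ * m) = d₁ * (4 * m) := by ring
        _ = d * ((2 * c' : ℕ) : ℤ) ^ 2 := hD
        _ = 4 * (d * (c' : ℤ) ^ 2) := by push_cast; ring
    -- reduce `d₁ m = d c'²` modulo `4`: `m ≡ d c'² (mod 4)` with `d c'² ≡ 0` or `d (mod 4)`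
    have hlhs : (d₁ * m) % 4 = m % 4 := by
      rw [Int.mul_emod, hd₁odd, one_mul, Int.emod_emod_of_dvd _ (dvd_refl _)]
    have hsq4 : ((c' : ℤ) ^ 2) % 4 = 0 ∨ ((c' : ℤ) ^ 2) % 4 = 1 := by
      rcases Int.even_or_odd' (c' : ℤ) with ⟨j, hj | hj⟩
      · left
        rw [hj, show (2 * j) ^ 2 = 0 + 4 * j ^ 2 by ring, Int.add_mul_emod_self_left]
        norm_num
      · right
        rw [hj, show (2 * j + 1) ^ 2 = 1 + 4 * (j ^ 2 + j) by ring, Int.add_mul_emod_self_left]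
        norm_num
    have hmod := congrArg (· % (4 : ℤ)) hE
    simp only [hlhs] at hmod
    rw [Int.mul_emod] at hmod
    rcases hsq4 with h0 | h1
    · rw [h0, mul_zero, Int.zero_emod] at hmod
      omega
    · rw [h1, mul_one, Int.emod_emod_of_dvd _ (dvd_refl _)] at hmod
      omega

/-! ## Ramification above the conductor -/

variable {K : Type} [Field K] [NumberField K]

/-- Square roots in `ℚ̄` of a non-zero integer agree up to sign, so `γ` fixes one iff it fixes
the other. [folklore] -/
private theorem smul_eq_iff_of_sq_eq_rat {s s' : AlgebraicClosure ℚ} {d : ℤ} (hd : d ≠ 0)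
    (hs : s ^ 2 = (d : AlgebraicClosure ℚ)) (hs' : s' ^ 2 = (d : AlgebraicClosure ℚ))
    (γ : absoluteGaloisGroup ℚ) : γ • s = s ↔ γ • s' = s' := by
  have hs0 : s ≠ 0 := by
    rintro rfl
    rw [zero_pow two_ne_zero] at hs
    exact hd (by exact_mod_cast hs.symm)
  rcases sq_eq_sq_iff_eq_or_eq_neg.mp (hs'.trans hs.symm) with rfl | rfl
  · exact Iff.rfl
  · rw [smul_neg, neg_inj]

/-- `γ ∈ Γ_ℚ` moves a square root of an integer to `±` itself. [folklore] -/
private theorem smul_eq_or_eq_neg_rat {s : AlgebraicClosure ℚ} {d : ℤ}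
    (hs : s ^ 2 = (d : AlgebraicClosure ℚ)) (γ : absoluteGaloisGroup ℚ) :
    γ • s = s ∨ γ • s = -s := by
  apply sq_eq_sq_iff_eq_or_eq_neg.mp
  rw [absoluteGaloisGroup.smul_def, ← map_pow, hs, map_intCast]

/-- For a non-zero `s` in characteristic zero, `-s ≠ s`. [folklore] -/
private theorem neg_ne_self_rat {s : AlgebraicClosure ℚ} (hs : s ≠ 0) : -s ≠ s := by
  intro h
  apply hs
  have h2 : (2 : AlgebraicClosure ℚ) * s = 0 := by linear_combination (-1 : AlgebraicClosure ℚ) * h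
  rcases mul_eq_zero.mp h2 with h3 | h3
  · exact absurd h3 two_ne_zero
  · exact h3

/-- **A rational character is ramified above every prime dividing the conductor.** Let `K` be a
quadratic field, `d₁`, `d₂` fundamental discriminants with `d₁ d₂ = d_K c²`, and `χ_gal` a
character of `Γ_K` rational for `d₁` (Gross 2004 §2: the rational ring class character of the
order of conductor `c` attached to `D = d₁ d₂`). Then for every prime `p ∣ c` and every place
`v ∣ p` of `K`, `χ_gal` (i.e. `ofCharacter χ_gal`) is NOT unramified at `v`: there is an inertia
element `σ ∈ I_𝔓 ≤ Γ_K`, `𝔓 ∣ v`, with `σ √d₁ = −√d₁`. Proof: `p ∣ d₁` and `p ∣ d₂`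
(`Int.dvd_of_prime_dvd_conductor`); an inertia element `τ₁` of `Γ_ℚ` above `p` negating `√d₁`
exists (`exists_mem_inertia_smul_eq_neg_of_sq_eq_fundamental`); if it moves `√d_K`, replace it by
`τ₂` (negating `√d₂ = c√d_K/√d₁`) or by `τ₁τ₂`, so as to fix `√d_K`; an element of `Γ_ℚ` fixing
`√d_K` is the restriction of some `σ ∈ Γ_K` (`mem_range_absGaloisRestrict_iff_smul_gen_eq`), which is
an inertia element above `v` (`comap_inertia_comap_absIntegersMap`). (Neukirch I §9 (9.4)–(9.6);
this is the conductor-`c` statement for genus characters, Cox §7.)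
[cite: Gross2004, §2 p. 40 (rational characters of conductor c ↔ D = d₁d₂)]
[cite: NeukirchANT1999, Ch. I §9 (9.4)–(9.6) with §8] -/
theorem not_isUnramifiedAt_of_isRationalCharacterFor_of_dvd_conductor
    (h2 : finrank ℚ K = 2) {χgal : absoluteGaloisGroup K →ₜ* ℂˣ} {d₁ d₂ : ℤ}
    (hχ : IsRationalCharacterFor χgal d₁)
    (hfund₁ : (d₁ % 4 = 1 ∧ Squarefree d₁ ∧ d₁ ≠ 1) ∨
      (4 ∣ d₁ ∧ (d₁ / 4 % 4 = 2 ∨ d₁ / 4 % 4 = 3) ∧ Squarefree (d₁ / 4)))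
    (hfund₂ : (d₂ % 4 = 1 ∧ Squarefree d₂ ∧ d₂ ≠ 1) ∨
      (4 ∣ d₂ ∧ (d₂ / 4 % 4 = 2 ∨ d₂ / 4 % 4 = 3) ∧ Squarefree (d₂ / 4)))
    {c : ℕ} (hD : d₁ * d₂ = NumberField.discr K * (c : ℤ) ^ 2) {p : ℕ} (hp : p.Prime)
    (hpc : p ∣ c) {v : HeightOneSpectrum (𝓞 K)} (hv : ((p : ℕ) : 𝓞 K) ∈ v.asIdeal) :
    ¬ GaloisRep.IsUnramifiedAt v (FramedArtinRep.toArtinRep (FramedRep.ofCharacter χgal)) := by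
  classical
  rw [isUnramifiedAt_ofCharacter_iff]
  intro hunr
  -- arithmetic
  have hd4 := Quadratic.discr_emod_four (K := K) h2
  have hpd₁ : (p : ℤ) ∣ d₁ := Int.dvd_of_prime_dvd_conductor hd4 hfund₁ hfund₂ hD hp hpc
  have hpd₂ : (p : ℤ) ∣ d₂ :=
    Int.dvd_of_prime_dvd_conductor hd4 hfund₂ hfund₁ (by rw [mul_comm]; exact hD) hp hpc
  have hd₁0 : d₁ ≠ 0 := by
    rcases hfund₁ with ⟨h1, -, -⟩ | ⟨-, -, hsq⟩ <;> [omega; exact fun h ↦ by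
      rw [h] at hsq; simp at hsq]
  have hd₂0 : d₂ ≠ 0 := by
    rcases hfund₂ with ⟨h1, -, -⟩ | ⟨-, -, hsq⟩ <;> [omega; exact fun h ↦ by
      rw [h] at hsq; simp at hsq]
  have hdK0 : NumberField.discr K ≠ 0 := NumberField.discr_ne_zero K
  -- square roots in `ℚ̄`
  obtain ⟨s₁, hs₁⟩ := IsAlgClosed.exists_pow_nat_eq (d₁ : AlgebraicClosure ℚ) two_pos
  obtain ⟨sK, hsK⟩ := IsAlgClosed.exists_pow_nat_eq (NumberField.discr K : AlgebraicClosure ℚ) two_pos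
  have hs₁0 : s₁ ≠ 0 := by
    rintro rfl; rw [zero_pow two_ne_zero] at hs₁; exact hd₁0 (by exact_mod_cast hs₁.symm)
  have hsK0 : sK ≠ 0 := by
    rintro rfl; rw [zero_pow two_ne_zero] at hsK; exact hdK0 (by exact_mod_cast hsK.symm)
  set s₂ : AlgebraicClosure ℚ := (c : AlgebraicClosure ℚ) * sK / s₁ with hs₂def
  have hs₂ : s₂ ^ 2 = (d₂ : AlgebraicClosure ℚ) := by
    have hD' : ((d₁ : AlgebraicClosure ℚ)) * d₂ = (NumberField.discr K : AlgebraicClosure ℚ) * (c : AlgebraicClosure ℚ) ^ 2 := by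
      exact_mod_cast hD
    rw [hs₂def, div_pow, mul_pow, hsK, hs₁]
    field_simp
    linear_combination hD'.symm
  -- the place of `ℚ` below `v` and the primes of `\bar ℤ`, `\bar ℤ_K`
  set v₀ : HeightOneSpectrum (𝓞 ℚ) := v.under (𝓞 ℚ) with hv₀
  have hv₀p : ((p : ℕ) : 𝓞 ℚ) ∈ v₀.asIdeal := by
    rw [hv₀, HeightOneSpectrum.under_asIdeal, Ideal.under_def, Ideal.mem_comap, map_natCast]
    exact hv
  obtain ⟨𝔓, h𝔓⟩ := v.primesAbove_nonempty
  have h𝔓₀ : 𝔓.comap (absIntegersMap ℚ K) ∈ v₀.primesAbove :=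
    comap_absIntegersMap_mem_primesAbove (by rw [hv₀, HeightOneSpectrum.under_asIdeal]) h𝔓
  -- the image of `Γ_K` in `Γ_ℚ` is the stabiliser of `√d_K`
  obtain ⟨e, he⟩ := exists_mem_range_absGaloisRestrict_iff ℚ K
  obtain ⟨δ, hδ, hδsq⟩ := Quadratic.exists_not_mem_range_sq_eq_discr (K := K) h2
  have heδ : (e δ) ^ 2 = (NumberField.discr K : AlgebraicClosure ℚ) := by
    rw [← map_pow, hδsq, AlgHom.commutes]; simp
  have hrange : ∀ g : absoluteGaloisGroup ℚ,
      g ∈ (absGaloisRestrict ℚ K).range ↔ g • sK = sK := by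
    intro g
    rw [mem_range_absGaloisRestrict_iff_smul_gen_eq h2 hδ he g, smul_eq_iff_of_sq_eq_rat hdK0 heδ hsK]
  -- an inertia element of `Γ_ℚ` negating `s₁` and fixing `sK`
  have key : ∃ τ ∈ (𝔓.comap (absIntegersMap ℚ K)).inertia (absoluteGaloisGroup ℚ),
      τ • s₁ = -s₁ ∧ τ • sK = sK := by
    obtain ⟨τ₁, hτ₁I, hτ₁⟩ :=
      exists_mem_inertia_smul_eq_neg_of_sq_eq_fundamental hfund₁ hp hpd₁ hs₁ hv₀p h𝔓₀
    rcases smul_eq_or_eq_neg_rat hsK τ₁ with hK | hK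
    · exact ⟨τ₁, hτ₁I, hτ₁, hK⟩
    · obtain ⟨τ₂, hτ₂I, hτ₂⟩ :=
        exists_mem_inertia_smul_eq_neg_of_sq_eq_fundamental hfund₂ hp hpd₂ hs₂ hv₀p h𝔓₀
      -- `τ₂ s₂ = c (τ₂ sK) / (τ₂ s₁)`
      have hτ₂s₂ : τ₂ • s₂ = (c : AlgebraicClosure ℚ) * (τ₂ • sK) / (τ₂ • s₁) := by
        rw [hs₂def, absoluteGaloisGroup.smul_def, absoluteGaloisGroup.smul_def,
          absoluteGaloisGroup.smul_def, map_div₀, map_mul, map_natCast]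
      rcases smul_eq_or_eq_neg_rat hs₁ τ₂ with h1 | h1 <;>
        rcases smul_eq_or_eq_neg_rat hsK τ₂ with hK2 | hK2
      · -- `τ₂` fixes both: then `τ₂ s₂ = s₂`, contradiction
        exfalso
        rw [h1, hK2, ← hs₂def] at hτ₂s₂
        have hs₂0 : s₂ ≠ 0 := by
          rintro h0; rw [h0, zero_pow two_ne_zero] at hs₂; exact hd₂0 (by exact_mod_cast hs₂.symm)
        exact neg_ne_self_rat hs₂0 (hτ₂.symm.trans hτ₂s₂)
      · -- `τ₂` fixes `s₁`, negates `sK`: take `τ₁ τ₂`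
        refine ⟨τ₁ * τ₂, mul_mem hτ₁I hτ₂I, ?_, ?_⟩
        · rw [mul_smul, h1, hτ₁]
        · rw [mul_smul, hK2, smul_neg, hK, neg_neg]
      · -- `τ₂` negates `s₁`, fixes `sK`: take `τ₂`
        exact ⟨τ₂, hτ₂I, h1, hK2⟩
      · -- `τ₂` negates both: then `τ₂ s₂ = s₂`, contradiction
        exfalso
        rw [h1, hK2, mul_neg, neg_div_neg_eq, ← hs₂def] at hτ₂s₂
        have hs₂0 : s₂ ≠ 0 := by
          rintro h0; rw [h0, zero_pow two_ne_zero] at hs₂; exact hd₂0 (by exact_mod_cast hs₂.symm)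
        exact neg_ne_self_rat hs₂0 (hτ₂.symm.trans hτ₂s₂)
  obtain ⟨τ, hτI, hτ₁, hτK⟩ := key
  -- `τ = res σ` with `σ` an inertia element of `Γ_K` at `𝔓`
  obtain ⟨σ, rfl⟩ : τ ∈ (absGaloisRestrict ℚ K).range := (hrange τ).mpr hτK
  have hσI : σ ∈ 𝔓.inertia (absoluteGaloisGroup K) := by
    rw [← comap_inertia_comap_absIntegersMap ℚ K 𝔓, Subgroup.mem_comap]
    exact hτI
  -- `σ` negates `√d₁ ∈ K̄`
  set r₁ : AlgebraicClosure K := absClosureEmbedding ℚ K s₁ with hr₁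
  have hr₁sq : r₁ ^ 2 = (d₁ : AlgebraicClosure K) := by
    rw [hr₁, ← map_pow, hs₁, map_intCast]
  have hτ₁' : absGaloisRestrict ℚ K σ • s₁ = -s₁ := hτ₁
  have hσr₁ : σ • r₁ = -r₁ := by
    rw [hr₁, ← absGaloisRestrict_apply_smul, hτ₁', map_neg]
  have hr₁0 : r₁ ≠ 0 := by
    rw [hr₁]; exact (_root_.map_ne_zero _).mpr hs₁0
  have hne : σ • r₁ ≠ r₁ := by rw [hσr₁]; exact fun h ↦ hr₁0 (by
    have h2 : (2 : AlgebraicClosure K) * r₁ = 0 := by linear_combination (-1 : AlgebraicClosure K) * h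
    rcases mul_eq_zero.mp h2 with h3 | h3
    · exact absurd h3 two_ne_zero
    · exact h3)
  exact hne ((hχ.apply_eq_one_iff_smul_eq hd₁0 hr₁sq σ).mp (hunr 𝔓 h𝔓 σ hσI))

/-- **`heckeValueAt χ_gal v = 0` above the conductor** ("`𝒲` extended by zero to the ideals not
prime to `𝔣`", Nekovář 1995 §3.4): for `K` quadratic, `d₁ d₂ = d_K c²` fundamental, `χ_gal`
rational for `d₁`, `p ∣ c` and `v ∣ p`, the Galois-currency value of `χ_gal` at `v` vanishes —
the Rankin–Selberg Euler factor of `L(f, χ, s)` at `v` is `1`. [cite: Nekovar1995, §3.4]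
[cite: Gross2004, §2 p. 40 (rational characters of conductor c ↔ D = d₁d₂)] -/
theorem heckeValueAt_eq_zero_of_isRationalCharacterFor_of_dvd_conductor
    (h2 : finrank ℚ K = 2) {χgal : absoluteGaloisGroup K →ₜ* ℂˣ} {d₁ d₂ : ℤ}
    (hχ : IsRationalCharacterFor χgal d₁)
    (hfund₁ : (d₁ % 4 = 1 ∧ Squarefree d₁ ∧ d₁ ≠ 1) ∨
      (4 ∣ d₁ ∧ (d₁ / 4 % 4 = 2 ∨ d₁ / 4 % 4 = 3) ∧ Squarefree (d₁ / 4)))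
    (hfund₂ : (d₂ % 4 = 1 ∧ Squarefree d₂ ∧ d₂ ≠ 1) ∨
      (4 ∣ d₂ ∧ (d₂ / 4 % 4 = 2 ∨ d₂ / 4 % 4 = 3) ∧ Squarefree (d₂ / 4)))
    {c : ℕ} (hD : d₁ * d₂ = NumberField.discr K * (c : ℤ) ^ 2) {p : ℕ} (hp : p.Prime)
    (hpc : p ∣ c) (v : HeightOneSpectrum (𝓞 K)) (hv : ((p : ℕ) : 𝓞 K) ∈ v.asIdeal) :
    heckeValueAt χgal v = 0 :=
  heckeValueAt_eq_zero_of_not_isUnramifiedAt _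
    (not_isUnramifiedAt_of_isRationalCharacterFor_of_dvd_conductor h2 hχ hfund₁ hfund₂ hD hp hpc hv)

end Gross2004

end Literature.NumberTheory.EllipticCurves

end
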